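import Literature.AlgebraicGeometry.Motives.SubschemeCyclesBaseChangeProofs
import Literature.AlgebraicGeometry.Motives.BettiCycleClassProofs
import Literature.AlgebraicGeometry.Resolution.ResolutionOfCurves
import Mathlib.AlgebraicGeometry.Morphisms.UniversallyOpen
import Mathlib.AlgebraicGeometry.Fiber
import HarnessLib

/-!
# Irreducible components of a base change `T ×ₖ Spec K'` have the dimensions of those of `T`

Topic: `Literature/AlgebraicGeometry/Resolution`. For a scheme `T` locally of finite type over a
field `K`, a field homomorphism `σ : K → K'` and a cartesian square `T' = T ×_{K,σ} Spec K' → T`: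
**if every irreducible component of `T` has dimension `d`, so does every irreducible component of
`T'`** (`topologicalKrullDim_of_mem_irreducibleComponents_of_isPullback`; Görtz–Wedhorn I,
Prop. 5.38 with Exercise 5.12 and Cor. 5.45; EGA IV₂ (4.2.7)). In particular, for a cartesian
square of schemes `P = X ×_Y Y'` and `y' ∈ Y'`, if every irreducible component of the fibre
`X_{ψ(y')}` has dimension `d` then so has every irreducible component of the fibre `P_{y'}`
(`topologicalKrullDim_fiber_of_isPullback`), the fibre square
`P_{y'} = X_{ψ y'} ×_{κ(ψ y')} Spec κ(y')` being cartesian (Mathlib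
`isPullback_fiberToSpecResidueField_of_isPullback`). This is the part of de Jong 1996, 4.15 "It is
easy to see that the morphism `f'` satisfies (vi) a)–c)" concerning "(vi) a) All fibres are […]
equidimensional of dimension 1".

Proof. Generic points `z` of irreducible components are the maximal points for generisation
(`mem_genericPoints_iff_isMax`), and the dimension of a component is the height of its generic
point in the specialisation order (`topologicalKrullDim_closure_singleton_eq_height`). For such a
`z ∈ T'` over `x ∈ T`: in affine charts `U' = Spec R' → U = Spec R`, `R' = R ⊗ₖ K'`
(Mathlib `isIso_pushoutSection_of_isAffineOpen`), the prime `𝔮` of `z` is a minimal prime of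
`R'`, hence minimal over `𝔭R'`, `𝔭 = 𝔮 ∩ R` the prime of `x`, so `dim R' ⧸ 𝔮 = dim R ⧸ 𝔭`
(`Literature.RingTheory.KrullDimension.ringKrullDim_quotient_eq_of_isPushout_of_mem_minimalPrimes`,
the dimension of the components of `(R ⧸ 𝔭) ⊗ₖ K'`), i.e. `height z = height x`
(`height_eq_height_apply_of_isMax`, the chart formula
`Literature.AlgebraicGeometry.Dimension.Scheme.height_eq_ringKrullDim_quotient_primeIdealOf`); and
`x` is again a maximal point because the flat `T' → T` is generising (Mathlib
`Flat.generalizingMap`).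

## Sources

* U. Görtz, T. Wedhorn, *Algebraic Geometry I: Schemes*, 2nd ed. (2020), Prop. 5.38,
  Exercise 5.12, Cor. 5.45.
* A. Grothendieck, J. Dieudonné, EGA IV₂ (1965), Prop. (4.2.7), Cor. (4.2.8).
* A. J. de Jong, *Smoothness, semi-stability and alterations*, Publ. Math. IHÉS 83 (1996), 4.15
  (p. 71).
-/

noncomputable section

universe u

open CategoryTheory CategoryTheory.Limits AlgebraicGeometry Order Topology TopologicalSpace

namespace Literature.AlgebraicGeometry.Resolution

/-! ## Generic points of components are the maximal points for generisation -/

section GenericPoints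

variable {S : Scheme.{u}}

/-- In a scheme, a point is the generic point of an irreducible component iff it is maximal in
the specialisation order `a ≤ b ↔ b ⤳ a`, i.e. it has no proper generisation. [folklore] -/
theorem mem_genericPoints_iff_isMax (x : S) : x ∈ genericPoints S ↔ IsMax x := by
  constructor
  · intro hx y hxy
    -- `closure {y} ⊇ closure {x}` is irreducible, hence equal by maximality
    have hyx : y ⤳ x := Scheme.le_iff_specializes.mp hxy
    have hsub : closure ({x} : Set S) ⊆ closure {y} :=
      closure_minimal (Set.singleton_subset_iff.mpr hyx.mem_closure) isClosed_closure
    have hle : closure ({y} : Set S) ⊆ closure {x} := hx.2 isIrreducible_singleton.closure hsub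
    exact Scheme.le_iff_specializes.mpr
      (specializes_iff_mem_closure.mpr (hle (subset_closure (Set.mem_singleton y))))
  · intro hx
    refine ⟨isIrreducible_singleton.closure, fun t ht hxt => ?_⟩
    -- the generic point `y` of `closure t` generises `x`, hence `x ⤳ y`
    have hy := ht.isGenericPoint_genericPoint_closure
    have hxmem : x ∈ closure t := subset_closure (hxt (subset_closure (Set.mem_singleton x)))
    have hyx : ht.genericPoint ⤳ x := hy.specializes hxmem
    have hxy : x ⤳ ht.genericPoint :=
      Scheme.le_iff_specializes.mp (hx (Scheme.le_iff_specializes.mpr hyx))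
    calc t ⊆ closure t := subset_closure
      _ = closure {ht.genericPoint} := hy.symm
      _ ⊆ closure {x} :=
        closure_minimal (Set.singleton_subset_iff.mpr hxy.mem_closure) isClosed_closure

/-- The generic point of an irreducible component of a scheme is a maximal point. [folklore] -/
theorem isMax_of_isGenericPoint_of_mem_irreducibleComponents {x : S} {C : Set S}
    (hC : C ∈ irreducibleComponents S) (hx : IsGenericPoint x C) : IsMax x :=
  (mem_genericPoints_iff_isMax x).mp (show closure {x} ∈ irreducibleComponents S from hx.symm ▸ hC)

/-- **The dimension of the closure of a point is its height** in the specialisation order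
(`a ≤ b ↔ b ⤳ a`) — via the reduced closed subscheme on `closure {x}`, an integral scheme whose
generic point maps to `x` (`Literature.AlgebraicGeometry.Motives.Scheme.height_genericPoint`,
`…height_base_eq_of_isClosedImmersion`). [folklore] -/
theorem topologicalKrullDim_closure_singleton_eq_height (x : S) :
    topologicalKrullDim (closure ({x} : Set S)) = (height x : ℕ∞) := by
  open Scheme.IdealSheafData in
  set C : Closeds S := ⟨closure ({x} : Set S), isClosed_closure⟩ with hCdef
  have hCirr : IsIrreducible (C : Set S) := isIrreducible_singleton.closure
  haveI : IsIntegral (vanishingIdeal C).subscheme := isIntegral_subscheme_vanishingIdeal C hCirr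
  set ιC := (vanishingIdeal C).subschemeι with hιC
  have hrange : Set.range ιC = closure ({x} : Set S) := range_subschemeι_vanishingIdeal C
  -- the generic point of the subscheme maps to `x`
  set η := genericPoint (vanishingIdeal C).subscheme with hη
  have hgen : IsGenericPoint (ιC η) (closure ({x} : Set S)) := by
    rw [isGenericPoint_def, ← Set.image_singleton,
      ιC.isClosedEmbedding.isClosedMap.closure_image_eq_of_continuous ιC.continuous,
      (genericPoint_spec (vanishingIdeal C).subscheme).def]
    simp [hrange]
  have hηx : ιC η = x := hgen.eq isGenericPoint_closure
  -- dimensions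
  have h1 : topologicalKrullDim (closure ({x} : Set S)) =
      topologicalKrullDim (vanishingIdeal C).subscheme := by
    let e : ((vanishingIdeal C).subscheme : Type u) ≃ₜ (closure ({x} : Set S)) :=
      ιC.isClosedEmbedding.isEmbedding.toHomeomorph.trans (Homeomorph.setCongr hrange)
    exact (IsHomeomorph.topologicalKrullDim_eq e e.isHomeomorph).symm
  have h3 : height η = height x := by
    rw [← hηx]
    exact (Literature.AlgebraicGeometry.Motives.Scheme.height_base_eq_of_isClosedImmersion ιC η).symm
  rw [h1, ← Literature.AlgebraicGeometry.Motives.Scheme.height_genericPoint, ← h3]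

/-- The dimension of an irreducible component is the height of its generic point. [folklore] -/
theorem topologicalKrullDim_eq_height_of_isGenericPoint {x : S} {C : Set S}
    (hx : IsGenericPoint x C) : topologicalKrullDim C = (height x : ℕ∞) := by
  have e : C = closure {x} := hx.symm
  subst e
  exact topologicalKrullDim_closure_singleton_eq_height x

/-- A generising map (e.g. a flat morphism) sends maximal points to maximal points. [folklore] -/
theorem isMax_apply_of_generalizingMap {S' : Scheme.{u}} (π : S' ⟶ S)
    (hπ : GeneralizingMap π) {z : S'} (hz : IsMax z) : IsMax (π z) := by
  intro y hy
  obtain ⟨z', hz'z, rfl⟩ := hπ (Scheme.le_iff_specializes.mp hy)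
  have : z ⤳ z' := Scheme.le_iff_specializes.mp (hz (Scheme.le_iff_specializes.mpr hz'z))
  exact Scheme.le_iff_specializes.mpr (this.map π.continuous)

end GenericPoints

/-! ## Heights of maximal points under base change of the ground field -/

section HeightBaseChange

variable {k L : Type u} [Field k] [Field L] (σ : k →+* L) {X X' : Scheme.{u}}
  (p : X ⟶ Spec (CommRingCat.of k)) (π : X' ⟶ X) (p' : X' ⟶ Spec (CommRingCat.of L))

/-- In an affine open `U' ∋ z`, the prime of a maximal point `z` is a minimal prime.
[folklore] -/
theorem primeIdealOf_mem_minimalPrimes_of_isMax {U' : X'.Opens} (hU' : IsAffineOpen U') {z : X'}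
    (hzU' : z ∈ U') (hz : IsMax z) :
    (hU'.primeIdealOf ⟨z, hzU'⟩).asIdeal ∈ minimalPrimes Γ(X', U') := by
  rw [minimalPrimes_eq_minimals]
  refine ⟨(hU'.primeIdealOf ⟨z, hzU'⟩).isPrime, fun Q hQ hQle => ?_⟩
  -- the point `z₀` of `Q` generises `z`, hence `z ⤳ z₀`, i.e. `𝔮 ≤ Q`
  let q₀ : PrimeSpectrum Γ(X', U') := ⟨Q, hQ⟩
  have h0 : hU'.fromSpec q₀ ⤳ z := by
    have := (Literature.AlgebraicGeometry.Dimension.Scheme.fromSpec_specializes_iff hU' q₀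
      (hU'.primeIdealOf ⟨z, hzU'⟩)).mpr hQle
    rwa [hU'.fromSpec_primeIdealOf] at this
  have h1 : z ⤳ hU'.fromSpec q₀ :=
    Scheme.le_iff_specializes.mp (hz (Scheme.le_iff_specializes.mpr h0))
  have h2 : hU'.primeIdealOf ⟨z, hzU'⟩ ≤ q₀ := by
    rw [← Literature.AlgebraicGeometry.Dimension.Scheme.fromSpec_specializes_iff hU',
      hU'.fromSpec_primeIdealOf]
    exact h1
  exact h2

/-- **Maximal points of `X ×ₖ Spec L` have the height of their image in `X`** (Görtz–Wedhorn I,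
Exercise 5.12 with Cor. 5.45: the components of `V_L` have dimension `dim V`). Let `X` be locally
of finite type over a field `k`, `σ : k →+* L` a field homomorphism, `π : X' = X ×_{k,σ} Spec L → X`
the projection of a cartesian square, and `z` a maximal point of `X'` (the generic point of an
irreducible component). Then `Order.height z = Order.height (π z)`. In affine charts
`U' = π⁻¹U = Spec R' → U = Spec R` one has `R' ≅ R ⊗ₖ L`
(`isIso_pushoutSection_of_isAffineOpen`); the prime `𝔮` of `z` is minimal, so minimal over
`𝔭R'` for `𝔭 = 𝔮 ∩ R` the prime of `π z`, and `dim R' ⧸ 𝔮 = dim R ⧸ 𝔭`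
(`ringKrullDim_quotient_eq_of_isPushout_of_mem_minimalPrimes`); conclude by the chart formula
`height = dim R ⧸ 𝔭` (`height_eq_ringKrullDim_quotient_primeIdealOf`).
[cite: GortzWedhorn2020, Exercise 5.12 and Cor. 5.45] -/
theorem height_eq_height_apply_of_isMax
    (H : IsPullback π p' p (Spec.map (CommRingCat.ofHom σ))) [LocallyOfFiniteType p] (z : X')
    (hzmax : IsMax z) : height z = height (π z) := by
  classical
  haveI : LocallyOfFiniteType p' :=
    MorphismProperty.of_isPullback (P := @LocallyOfFiniteType) H inferInstance
  haveI : IsAffineHom π := MorphismProperty.of_isPullback (P := @IsAffineHom) H.flip inferInstance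
  -- affine charts `U ∋ π z` and `U' = π⁻¹ U ∋ z`
  obtain ⟨_, ⟨U, hU, rfl⟩, hxU, -⟩ :=
    X.isBasis_affineOpens.exists_subset_of_mem_open (Set.mem_univ (π z)) isOpen_univ
  have hU' : IsAffineOpen (π ⁻¹ᵁ U) := hU.preimage π
  have hzU' : z ∈ π ⁻¹ᵁ U := hxU
  -- heights in the charts (Görtz–Wedhorn I, Thm. 5.22)
  have hz := Literature.AlgebraicGeometry.Dimension.Scheme.height_eq_ringKrullDim_quotient_primeIdealOf
    p' hU' hzU'
  have hxh := Literature.AlgebraicGeometry.Dimension.Scheme.height_eq_ringKrullDim_quotient_primeIdealOf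
    p hU hxU
  -- rings, primes and algebra structures
  set 𝔮 := hU'.primeIdealOf ⟨z, hzU'⟩ with h𝔮def
  set 𝔭 := hU.primeIdealOf ⟨π z, hxU⟩ with h𝔭def
  let φ : Γ(X, U) ⟶ Γ(X', π ⁻¹ᵁ U) := π.appLE U (π ⁻¹ᵁ U) le_rfl
  let ιk : CommRingCat.of k ⟶ Γ(Spec (CommRingCat.of k), ⊤) :=
    (Scheme.ΓSpecIso (CommRingCat.of k)).inv
  let ιL : CommRingCat.of L ⟶ Γ(Spec (CommRingCat.of L), ⊤) :=
    (Scheme.ΓSpecIso (CommRingCat.of L)).inv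
  let fk : CommRingCat.of k ⟶ Γ(X, U) := ιk ≫ p.appLE ⊤ U le_top
  let gL : CommRingCat.of L ⟶ Γ(X', π ⁻¹ᵁ U) := ιL ≫ p'.appLE ⊤ (π ⁻¹ᵁ U) le_top
  letI : Algebra k L := σ.toAlgebra
  letI : Algebra Γ(X, U) Γ(X', π ⁻¹ᵁ U) := φ.hom.toAlgebra
  letI : Algebra k Γ(X, U) := fk.hom.toAlgebra
  letI : Algebra L Γ(X', π ⁻¹ᵁ U) := gL.hom.toAlgebra
  letI : Algebra k Γ(X', π ⁻¹ᵁ U) := (φ.hom.comp fk.hom).toAlgebra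
  haveI : IsScalarTower k Γ(X, U) Γ(X', π ⁻¹ᵁ U) := IsScalarTower.of_algebraMap_eq fun _ ↦ rfl
  -- `appLE ⊤ ⊤` is `appTop`, and `appLE` only depends on the morphism
  have happTop : ∀ {Y Z : Scheme.{u}} (g : Y ⟶ Z), g.appLE ⊤ ⊤ le_top = g.appTop := by
    intro Y Z g
    rw [Scheme.Hom.appTop, Scheme.Hom.app_eq_appLE]
    rfl
  have happ : ∀ {g₁ g₂ : X' ⟶ Spec (CommRingCat.of k)} (_ : g₁ = g₂)
      (h₁ : π ⁻¹ᵁ U ≤ g₁ ⁻¹ᵁ ⊤) (h₂ : π ⁻¹ᵁ U ≤ g₂ ⁻¹ᵁ ⊤),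
      g₁.appLE ⊤ (π ⁻¹ᵁ U) h₁ = g₂.appLE ⊤ (π ⁻¹ᵁ U) h₂ := by
    rintro g₁ _ rfl _ _
    rfl
  -- the square `k → Γ(X, U)`, `k → L`, `Γ(X, U) → Γ(X', U')`, `L → Γ(X', U')` commutes ...
  have hsq : fk ≫ φ = CommRingCat.ofHom σ ≫ gL := by
    have h1 : fk ≫ φ = ιk ≫ (π ≫ p).appLE ⊤ (π ⁻¹ᵁ U) le_top := by
      simp only [fk, φ, Category.assoc, Scheme.Hom.appLE_comp_appLE]
    have h2 : CommRingCat.ofHom σ ≫ gL = ιk ≫ (p' ≫ Spec.map (CommRingCat.ofHom σ)).appLE ⊤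
        (π ⁻¹ᵁ U) le_top := by
      simp only [gL, ιL, ιk, ← Category.assoc]
      rw [Scheme.ΓSpecIso_inv_naturality, Category.assoc, ← happTop, Scheme.Hom.appLE_comp_appLE]
    rw [h1, h2, happ H.w]
  have hsq' : φ.hom.comp fk.hom = gL.hom.comp σ := by
    have := congrArg CommRingCat.Hom.hom hsq
    simpa only [CommRingCat.hom_comp, CommRingCat.hom_ofHom] using this
  haveI : IsScalarTower k L Γ(X', π ⁻¹ᵁ U) :=
    IsScalarTower.of_algebraMap_eq fun a ↦ congr($hsq' a)
  -- ... and is a pushout (Mathlib: sections of a fibre product over affine opens)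
  haveI : Algebra.IsPushout k Γ(X, U) L Γ(X', π ⁻¹ᵁ U) := by
    have hUY : π ⁻¹ᵁ U = π ⁻¹ᵁ U ⊓ p' ⁻¹ᵁ ⊤ := by simp
    have hiso := isIso_pushoutSection_of_isAffineOpen H (US := ⊤) (UT := ⊤) (UX := U)
      le_top le_top hUY (isAffineOpen_top _) (isAffineOpen_top _) hU
    have hpo := (isIso_pushoutSection_iff H (US := ⊤) (UT := ⊤) (UX := U) le_top le_top hUY).mp
      hiso
    have hpo' : IsPushout fk (CommRingCat.ofHom σ) φ gL := by
      refine hpo.of_iso (Scheme.ΓSpecIso (CommRingCat.of k)) (Iso.refl _)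
        (Scheme.ΓSpecIso (CommRingCat.of L)) (Iso.refl _) ?_ ?_ ?_ ?_
      · simp [fk, ιk]
      · rw [happTop]
        exact Scheme.ΓSpecIso_naturality _
      · simp [φ]
      · simp [gL, ιL]
    exact (CommRingCat.isPushout_iff_isPushout (R := k) (S := L) (R' := Γ(X, U))
      (S' := Γ(X', π ⁻¹ᵁ U))).mp hpo'
  -- `𝔮` is a minimal prime (as `z` is a maximal point), hence minimal over `𝔭 Γ(X', U')`
  have hcomap : 𝔭.asIdeal = Ideal.comap φ.hom 𝔮.asIdeal :=
    congr($(IsAffineOpen.comap_primeIdealOf_appLE U hU (π ⁻¹ᵁ U) hU' le_rfl hzU').1).symm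
  have hmin : 𝔮.asIdeal ∈ (𝔭.asIdeal.map φ.hom).minimalPrimes := by
    have hqmin : 𝔮.asIdeal ∈ minimalPrimes Γ(X', π ⁻¹ᵁ U) :=
      primeIdealOf_mem_minimalPrimes_of_isMax hU' hzU' hzmax
    refine ⟨⟨𝔮.isPrime, ?_⟩, fun Q hQ hQle => hqmin.2 ⟨hQ.1, bot_le⟩ hQle⟩
    rw [hcomap]
    exact Ideal.map_comap_le
  -- conclude with the dimension of the components of `(R ⧸ 𝔭) ⊗ₖ L`
  haveI : (𝔮.asIdeal).IsPrime := 𝔮.isPrime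
  haveI : Algebra.FiniteType k Γ(X, U) := by
    have h1 : (p.appLE ⊤ U le_top).hom.FiniteType :=
      p.finiteType_appLE (isAffineOpen_top _) hU le_top
    have h2 : ιk.hom.FiniteType :=
      RingHom.FiniteType.of_surjective _
        (Scheme.ΓSpecIso (CommRingCat.of k)).symm.commRingCatIsoToRingEquiv.surjective
    exact h1.comp h2
  have hunder : 𝔮.asIdeal.under Γ(X, U) = 𝔭.asIdeal := hcomap.symm
  have key := Literature.RingTheory.KrullDimension.ringKrullDim_quotient_eq_of_isPushout_of_mem_minimalPrimes
    (k := k) (L := L) (R := Γ(X, U)) 𝔮.asIdeal (by rw [hunder]; exact hmin)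
  rw [hunder] at key
  have : ((height z : ℕ∞) : WithBot ℕ∞) = ((height (π z) : ℕ∞) : WithBot ℕ∞) := by
    rw [hz, hxh, key]
  exact_mod_cast this

/-- **The irreducible components of `X ×ₖ Spec L` have the dimensions of those of `X`**
(Görtz–Wedhorn I, Prop. 5.38 / Exercise 5.12; EGA IV₂ (4.2.7)): for `X` locally of finite type
over a field `k`, a field homomorphism `σ : k →+* L` and a cartesian square
`π : X' = X ×_{k,σ} Spec L → X`, if every irreducible component of `X` has dimension `d` then
every irreducible component of `X'` has dimension `d`. Its generic point `z` is maximal, so is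
`π z` (the flat `π` is generising), `height z = height (π z)`
(`height_eq_height_apply_of_isMax`), and heights of generic points are dimensions of
components. [cite: GortzWedhorn2020, Prop. 5.38 and Exercise 5.12] -/
theorem topologicalKrullDim_of_mem_irreducibleComponents_of_isPullback
    (H : IsPullback π p' p (Spec.map (CommRingCat.ofHom σ))) [LocallyOfFiniteType p] {d : ℕ}
    (hX : ∀ C ∈ irreducibleComponents X, topologicalKrullDim C = d)
    {C' : Set X'} (hC' : C' ∈ irreducibleComponents X') : topologicalKrullDim C' = d := by
  -- the generic point `z` of `C'` is a maximal point
  have hz : IsGenericPoint (genericPoints.ofComponent ⟨C', hC'⟩).1 C' :=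
    genericPoints.isGenericPoint_ofComponent ⟨C', hC'⟩
  set z := (genericPoints.ofComponent ⟨C', hC'⟩).1 with hzdef
  have hzmax : IsMax z := isMax_of_isGenericPoint_of_mem_irreducibleComponents hC' hz
  -- `π z` is a maximal point: the flat `π` is generising
  haveI : Flat π := by
    -- `Spec L → Spec k` is flat (cf. `DeJong1996.Stage.flat_specMap`), hence so is `π`
    haveI : Flat (Spec.map (CommRingCat.ofHom σ)) := by
      have hσ : σ.Flat := by
        letI : Algebra k L := σ.toAlgebra
        exact (inferInstance : Module.Flat k L)
      rw [HasRingHomProperty.Spec_iff (P := @Flat)]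
      simpa using hσ
    exact MorphismProperty.of_isPullback (P := @Flat) H.flip inferInstance
  have hπz : IsMax (π z) := isMax_apply_of_generalizingMap π (Flat.generalizingMap π) hzmax
  have hmem : closure {π z} ∈ irreducibleComponents X := (mem_genericPoints_iff_isMax (π z)).mpr hπz
  have hd := hX _ hmem
  rw [topologicalKrullDim_closure_singleton_eq_height] at hd
  rw [topologicalKrullDim_eq_height_of_isGenericPoint hz,
    height_eq_height_apply_of_isMax σ p π p' H z hzmax]
  exact hd

end HeightBaseChange

/-! ## Fibres of a base change -/

section Fibres

/-- **Equidimensionality of fibres is preserved by base change.** For a cartesian square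
`P = X ×_Y Y'` (`fst : P → X`, `snd : P → Y'`) with `f : X → Y` locally of finite type and a
point `y' ∈ Y'`: if every irreducible component of the fibre `X_{ψ(y')}` has dimension `d`, then
every irreducible component of the fibre `P_{y'}` has dimension `d` — the fibre square
`P_{y'} = X_{ψ y'} ×_{κ(ψ y')} Spec κ(y')` is cartesian
(`isPullback_fiberToSpecResidueField_of_isPullback`). (De Jong 1996, 4.15: "(vi) a) […]
equidimensional of dimension 1" passes to `Y' ×_Y X → Y'`.)
[cite: GortzWedhorn2020, Prop. 5.38 and Exercise 5.12] -/
theorem topologicalKrullDim_fiber_of_isPullback {P X Y Y' : Scheme.{u}} {fst : P ⟶ X}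
    {snd : P ⟶ Y'} {f : X ⟶ Y} {ψ : Y' ⟶ Y} (h : IsPullback fst snd f ψ)
    [LocallyOfFiniteType f] {d : ℕ} (y' : Y')
    (hX : ∀ C ∈ irreducibleComponents ↥(f.fiber (ψ y')), topologicalKrullDim C = d)
    {C' : Set ↥(snd.fiber y')} (hC' : C' ∈ irreducibleComponents ↥(snd.fiber y')) :
    topologicalKrullDim C' = d := by
  have Hf := isPullback_fiberToSpecResidueField_of_isPullback h y'
  haveI : LocallyOfFiniteType (f.fiberToSpecResidueField (ψ y')) :=
    MorphismProperty.pullback_snd _ _ inferInstance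
  have Hf' : IsPullback (pullback.map snd (Y'.fromSpecResidueField y') f
      (Y.fromSpecResidueField (ψ y')) fst (Spec.map (ψ.residueFieldMap y')) ψ h.w.symm (by simp))
      (snd.fiberToSpecResidueField y') (f.fiberToSpecResidueField (ψ y'))
      (Spec.map (CommRingCat.ofHom (ψ.residueFieldMap y').hom)) := by
    simpa using Hf
  exact topologicalKrullDim_of_mem_irreducibleComponents_of_isPullback
    (k := Y.residueField (ψ y')) (L := Y'.residueField y') (ψ.residueFieldMap y').hom
    (f.fiberToSpecResidueField (ψ y')) _ (snd.fiberToSpecResidueField y') Hf' hX hC'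

end Fibres

end Literature.AlgebraicGeometry.Resolution

end
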